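import Summits.AtomisticToContinuum.HydrodynamicLimit.Theorems.CollisionIsometryCLTCollisionalTransferLocalityDefsB
import Summits.AtomisticToContinuum.HydrodynamicLimit.Theorems.AprioriBounds.Negative.ExpMomentTangent
import Summits.AtomisticToContinuum.HydrodynamicLimit.Theorems.AprioriBounds.Negative.BlockDensityAveraging
import Summits.AtomisticToContinuum.HydrodynamicLimit.Theorems.AprioriBounds.Negative.AdmissibleKernel
import Literature.Analysis.FluidPDE.HardSphereAlexander
import Literature.Analysis.FluidPDE.HardSphereFlowRegular
import Literature.Analysis.FluidPDE.HardSpherePhaseSpaceProofs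
import Literature.Analysis.FluidPDE.HardSphereTrajectoryMeasurable
import HarnessLib

/-!
# The `∀ t` dilute block ceiling of the line `hemisphere-affine-slaving` is false modulo a persistent jam

Negative lemma (registered as `ceilingAllTimes_false_of_persistentJam`) for the stub
`stub_ceilingAllTimes` [S'] of the skeleton (v9) of crux stmt-AtomisticToContinuum-9518
`CollisionalTransferLocality`, MODULO A HYPOTHESIS.  It does not refute the stub or the crux: the
hypothesis is not constructible today; it records in the kernel what the `∀ t > 0` of the filed form
costs (dual of `aprioriAllTimes_false_of_persistentVacuum`,
`Theorems/CollisionalTransferLocality/Negative/AprioriAllTimesFalseOfPersistentVacuum.lean`).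

The stub [S'] asks, for EVERY level `η₁ > 0` and all nice profiles, for a threshold `σ₀` (chosen
BEFORE the horizon) below which, for every flow family `Φ`, EVERY horizon `t > 0` and every admissible
kernel family, the dilute block ceiling `DiluteAt σ a₀ θ₀ u₀ Φ t φ η₁` holds: with local-Gibbs
probability `→ 1` no mesoscopic block density `ρ̄(s, x) = (N+1)⁻¹∑ᵢ φ_N(xᵢ(s) - x)` exceeds `η₁/σ³`
at any time `s ≤ t`.

HYPOTHESIS `PersistentJam` (the antecedent of the theorem, inlined; deliberately NOT a literature
fact and not tagged as one — nobody has derived it for hard spheres): for SOME level `η₁ > 0` and SOME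
nice profiles there is `σ₁ > 0` such that for all `0 < σ < σ₁` and every flow family there are a
window `0 ≤ t₁ < t₂` and a window-integrated limit density `ρI` with (1) a space–time law of large
numbers for the tested density under the local Gibbs laws,
`|∫_{t₁}^{t₂}(N+1)⁻¹∑ᵢχ(xᵢ(s))ds − ∫χρI| ≤ δ` w.h.p. for every continuous `χ` and `δ > 0`, and
(2) a JAM at level `η₁`: some continuous `0 ≤ χ ≤ 1` with `∫χ > 0` has
`(η₁/σ³)(t₂ − t₁)∫χ < ∫χρI` — the window-integrated limit density is denser than `η₁/σ³` in the
tested sense somewhere.  This is what ideal gas dynamics predicts at the focus of a smooth isentropic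
implosion of the limiting compressible Euler flow (Merle–Raphaël–Rodnianski–Szeftel 2022;
Buckmaster–Cao-Labora–Gómez-Serrano 2022): because `σ₀` precedes `t` and [S'] is `∀ η₁ > 0`, the
hard-sphere equation of state (`Z(η₁) = 1 + O(η₁)`) cannot intervene at small `η₁`.  Prose only; no
such statement is available for the particle system.

PROOF (dual of the vacuum lemma).  From [S'] at the jam level `η₁` and the jam profiles get `σ₀`; at a
common `σ < min σ₀ σ₁` (and `< 1/2`), Alexander's regularised flow family and the tree's torus
mollifier kernel family (`AprioriBoundsNegative.exists_admissibleKernelFamily`), [S'] with `t := t₂`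
gives w.h.p. the block CEILING `ρ̄(s, x) ≤ L := η₁/σ³` for all `s ≤ t₂` and all `x`.  Deterministic
core (`pj_empiricalDensityField_le_of_blockCeiling`, dual of the vacuum file's block-floor lemma): a
block ceiling forces the tested mass `(N+1)⁻¹∑ᵢχ(xᵢ) ≤ L∫χ + ε` for every continuous `0 ≤ χ ≤ 1`
once the kernel radius is below the `ε`-modulus of `χ` (write `χ(xᵢ) − ε ≤ ∫χ(x)φ_N(xᵢ − x)dx`, sum,
and bound `∫χρ̄ ≤ L∫χ`).  Integrating over `s ∈ [t₁, t₂]` along a good orbit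
(`pj_setIntegral_empiricalDensityField_le_mul`) gives `∫_{t₁}^{t₂}(N+1)⁻¹∑ᵢχ(xᵢ(s))ds ≤
(t₂ − t₁)(L∫χ + ε)`, contradicting the law of large numbers at the jam test function with
`δ = ε(t₂ − t₁) =` a quarter of the gap `∫χρI − L(t₂ − t₁)∫χ`.

The helper lemmas are adapted (dualised) from
`Theorems/CollisionalTransferLocality/Negative/AprioriAllTimesFalseOfPersistentVacuum.lean`
(themselves adapted from `Theorems/AprioriBounds/Negative/AprioriBoundsFalseOfPersistentVacuum.lean`,
refuter cdisprove 9519 cycle 3); neither module is imported (private helpers).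
-/

namespace Summit.AtomisticToContinuum.HydrodynamicLimit.Theorems.HemisphereAffineSlaving

open scoped BigOperators Topology ENNReal
open Filter Set Function MeasureTheory

noncomputable section

open Literature.MathematicalPhysics.KineticTheory (T3 V3)
open Literature.MathematicalPhysics.KineticTheory Literature.Analysis.FluidPDE

/-! ### Deterministic core: a block ceiling bounds the tested mass from above -/

-- adapted from Theorems/CollisionalTransferLocality/Negative/AprioriAllTimesFalseOfPersistentVacuum.lean (`pv_dist_le_euclidDist_sub_zero`)
/-- Mathlib's distance on `𝕋³` is dominated by the minimal-image distance in the crux's orientation: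
`dist x y ≤ euclidDist (y - x) 0` (`= euclidDist y x`, the crux measures kernel supports from `0`). -/
private theorem pj_dist_le_euclidDist_sub_zero (x y : T3) : dist x y ≤ Torus.euclidDist (y - x) 0 := by
  have h : Torus.euclidDist (y - x) 0 = Torus.euclidDist y x := by
    rw [Torus.euclidDist_eq, Torus.euclidDist_eq, sub_zero]
  rw [h, dist_eq_norm, ← norm_sub_rev]
  exact Torus.norm_sub_le_euclidDist_holds y x

-- adapted (dualised: floor ↦ ceiling) from Theorems/CollisionalTransferLocality/Negative/AprioriAllTimesFalseOfPersistentVacuum.lean (`pv_le_empiricalDensityField_of_blockFloor`)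
/-- **Block ceiling ⇒ tested-mass ceiling (deterministic, every configuration).**  Let `φ ≥ 0` be a
kernel of mass one vanishing outside the ball `{euclidDist · 0 < r}`, and `χ ≥ 0` a test function
with `r`-modulus `ε` (`χ y ≤ χ x + ε` whenever `euclidDist (y - x) 0 < r`).  If EVERY block of the
configuration `w` has density at most `L` (`(N+1)⁻¹∑ᵢ φ(xᵢ - x) ≤ L` for all `x`), then the tested
mass is at most `L ∫χ + ε`:  `(N+1)⁻¹ ∑ᵢ χ(xᵢ) ≤ L ∫ χ + ε`.  (Each `φ(xᵢ - ·)` is a probability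
density concentrated where `χ ≥ χ(xᵢ) - ε`, so `χ(xᵢ) - ε ≤ ∫ χ(x) φ(xᵢ - x) dx`; summing over `i`
gives `(N+1)⁻¹∑ᵢχ(xᵢ) - ε ≤ ∫ χ ρ̄ ≤ L ∫ χ`.) -/
private theorem pj_empiricalDensityField_le_of_blockCeiling {N : ℕ} (w : Config (N + 1) (Fin 3) T3)
    {φ : T3 → ℝ} (hφ0 : ∀ y, 0 ≤ φ y) (hφi : Integrable φ) (hφ1 : ∫ y, φ y = 1) {r : ℝ}
    (hsupp : ∀ y, r ≤ Torus.euclidDist y 0 → φ y = 0)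
    {χ : T3 → ℝ} (hχc : Continuous χ) (hχ0 : ∀ x, 0 ≤ χ x) (hχ1 : ∀ x, χ x ≤ 1) {ε : ℝ}
    (hmod : ∀ x y : T3, Torus.euclidDist (y - x) 0 < r → χ y ≤ χ x + ε)
    {L : ℝ} (hceil : ∀ x, empiricalDensityField w (fun y => φ (y - x)) ≤ L) :
    empiricalDensityField w χ ≤ L * (∫ x, χ x) + ε := by
  haveI : (volume : Measure T3).IsNegInvariant :=
    Measure.IsAddHaarMeasure.isNegInvariant_of_regular _
  have hχi : Integrable χ := by
    refine Integrable.of_bound (μ := volume) hχc.aestronglyMeasurable 1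
      (Eventually.of_forall fun x => ?_)
    rw [Real.norm_eq_abs, abs_of_nonneg (hχ0 x)]
    exact hχ1 x
  -- the block density as a finite sum
  set c : ℝ := ((N + 1 : ℕ) : ℝ)⁻¹ with hc
  have hc0 : 0 ≤ c := by positivity
  have hρ : ∀ x, empiricalDensityField w (fun y => φ (y - x)) = c * ∑ i, φ ((w i).1 - x) :=
    fun x => AprioriBoundsNegative.blockDensity_eq w φ x
  have hterm_int : ∀ i : Fin (N + 1), Integrable fun x => χ x * φ ((w i).1 - x) := fun i =>
    (hφi.comp_sub_left (w i).1).bdd_mul hχc.aestronglyMeasurable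
      (Eventually.of_forall fun x => by
        rw [Real.norm_eq_abs, abs_of_nonneg (hχ0 x)]; exact hχ1 x)
  -- each translated kernel, integrated against `χ`, is at least `χ(xᵢ) - ε`
  have hterm : ∀ i : Fin (N + 1), χ (w i).1 - ε ≤ ∫ x, χ x * φ ((w i).1 - x) := by
    intro i
    have hpt : ∀ x, (χ (w i).1 - ε) * φ ((w i).1 - x) ≤ χ x * φ ((w i).1 - x) := by
      intro x
      by_cases h0 : φ ((w i).1 - x) = 0
      · simp [h0]
      · have hlt : Torus.euclidDist ((w i).1 - x) 0 < r := by
          by_contra hge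
          exact h0 (hsupp _ (not_lt.1 hge))
        have hxy := hmod x (w i).1 hlt
        exact mul_le_mul_of_nonneg_right (by linarith) (hφ0 _)
    calc χ (w i).1 - ε = (χ (w i).1 - ε) * 1 := (mul_one _).symm
      _ = (χ (w i).1 - ε) * ∫ x, φ ((w i).1 - x) := by
          rw [integral_sub_left_eq_self φ volume, hφ1]
      _ = ∫ x, (χ (w i).1 - ε) * φ ((w i).1 - x) := (integral_const_mul _ _).symm
      _ ≤ ∫ x, χ x * φ ((w i).1 - x) :=
          integral_mono ((hφi.comp_sub_left (w i).1).const_mul _) (hterm_int i) hpt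
  -- the tested block density as a finite sum of integrable terms
  have hprod_eq : (fun x => χ x * empiricalDensityField w (fun y => φ (y - x))) =
      fun x => c * ∑ i, χ x * φ ((w i).1 - x) := by
    funext x; rw [hρ x, Finset.mul_sum, Finset.mul_sum, Finset.mul_sum]
    refine Finset.sum_congr rfl fun i _ => ?_; ring
  have hprod_int : Integrable fun x => χ x * empiricalDensityField w (fun y => φ (y - x)) := by
    rw [hprod_eq]; exact (integrable_finsetSum _ fun i _ => hterm_int i).const_mul _
  -- integrate the ceiling against `χ`
  have hup : ∫ x, χ x * empiricalDensityField w (fun y => φ (y - x)) ≤ L * ∫ x, χ x := by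
    rw [← integral_const_mul]
    refine integral_mono hprod_int (hχi.const_mul _) fun x => ?_
    have := mul_le_mul_of_nonneg_left (hceil x) (hχ0 x)
    linarith [mul_comm L (χ x)]
  have hlow : empiricalDensityField w χ - ε ≤
      ∫ x, χ x * empiricalDensityField w (fun y => φ (y - x)) := by
    rw [hprod_eq, integral_const_mul, integral_finsetSum _ (fun i _ => hterm_int i),
      AprioriBoundsNegative.empiricalDensityField_eq_sum]
    have hsum : ∑ i, (χ (w i).1 - ε) ≤ ∑ i, ∫ x, χ x * φ ((w i).1 - x) :=
      Finset.sum_le_sum fun i _ => hterm i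
    have h1 : c * ∑ i : Fin (N + 1), (χ (w i).1 - ε) = c * ∑ i, χ (w i).1 - ε := by
      rw [Finset.sum_sub_distrib, Finset.sum_const, Finset.card_univ, Fintype.card_fin,
        nsmul_eq_mul, mul_sub, ← mul_assoc c, hc, inv_mul_cancel₀ (by positivity), one_mul]
    calc c * ∑ i, χ (w i).1 - ε = c * ∑ i : Fin (N + 1), (χ (w i).1 - ε) := h1.symm
      _ ≤ c * ∑ i, ∫ x, χ x * φ ((w i).1 - x) := mul_le_mul_of_nonneg_left hsum hc0
  linarith [hlow.trans hup]

/-! ### Time integration along a good orbit -/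

-- adapted (dualised: lower ↦ upper bound) from Theorems/CollisionalTransferLocality/Negative/AprioriAllTimesFalseOfPersistentVacuum.lean (`pv_mul_le_setIntegral_empiricalDensityField`)
/-- Along the orbit of a good point, a pointwise ceiling `(N+1)⁻¹∑ᵢ χ(xᵢ(s)) ≤ L` on `[t₁, t₂]`
integrates to `∫_{[t₁,t₂]} (N+1)⁻¹∑ᵢ χ(xᵢ(s)) ds ≤ L (t₂ - t₁)` (the tested mass is measurable in
time along hard-sphere trajectories and takes values in `[0, 1]` for `0 ≤ χ ≤ 1`). -/
private theorem pj_setIntegral_empiricalDensityField_le_mul {N : ℕ} {ε' : ℝ}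
    (Φ : HardSphereFlow (Torus.geometry (Fin 3)) ε' (N + 1)) {z : Config (N + 1) (Fin 3) T3}
    (hz : z ∈ Φ.good) {χ : T3 → ℝ} (hχc : Continuous χ) (hχ0 : ∀ x, 0 ≤ χ x) (hχ1 : ∀ x, χ x ≤ 1)
    {t₁ t₂ L : ℝ} (ht : t₁ ≤ t₂)
    (hL : ∀ s ∈ Icc t₁ t₂, empiricalDensityField (Φ.flow s z) χ ≤ L) :
    ∫ s in Icc t₁ t₂, empiricalDensityField (Φ.flow s z) χ ≤ L * (t₂ - t₁) := by
  set γ : ℝ → Config (N + 1) (Fin 3) T3 := fun s => Φ.flow s z with hγ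
  have htraj : IsHardSphereTrajectory (Torus.geometry (Fin 3)) ε' (N + 1) γ := Φ.isTrajectory z hz
  have hγm : Measurable γ := htraj.measurable_torus
  have hχm : Measurable χ := hχc.measurable
  set c : ℝ := ((N + 1 : ℕ) : ℝ)⁻¹ with hc
  have hmwm : Measurable fun w : Config (N + 1) (Fin 3) T3 => empiricalDensityField w χ := by
    have : (fun w : Config (N + 1) (Fin 3) T3 => empiricalDensityField w χ) =
        fun w => c * ∑ i, χ (w i).1 :=
      funext fun w => AprioriBoundsNegative.empiricalDensityField_eq_sum w χ
    rw [this]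
    exact measurable_const.mul (Finset.measurable_sum _ fun i _ =>
      hχm.comp (measurable_pi_apply i).fst)
  set m : ℝ → ℝ := fun s => empiricalDensityField (Φ.flow s z) χ with hm
  have hmm : Measurable m := hmwm.comp hγm
  have hmb : ∀ s, 0 ≤ m s ∧ m s ≤ 1 := fun s =>
    AprioriBoundsNegative.empiricalDensityField_mem_Icc hχ0 hχ1 _
  haveI : IsFiniteMeasure (volume.restrict (Icc t₁ t₂)) := by infer_instance
  have hmi : Integrable m (volume.restrict (Icc t₁ t₂)) :=
    Integrable.of_bound hmm.aestronglyMeasurable 1 (Eventually.of_forall fun s => by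
      rw [Real.norm_eq_abs, abs_of_nonneg (hmb s).1]; exact (hmb s).2)
  have hae : ∀ᵐ s ∂(volume.restrict (Icc t₁ t₂)), m s ≤ (fun _ => L) s :=
    ae_restrict_of_forall_mem measurableSet_Icc fun s hs => hL s hs
  have hmono : ∫ s in Icc t₁ t₂, m s ≤ ∫ s in Icc t₁ t₂, (fun _ => L) s :=
    integral_mono_ae hmi (integrable_const L) hae
  have hconst : ∫ s in Icc t₁ t₂, (fun _ : ℝ => L) s = L * (t₂ - t₁) := by
    simp only
    rw [setIntegral_const, smul_eq_mul, Measure.real, Real.volume_Icc,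
      ENNReal.toReal_ofReal (by linarith), mul_comm]
  rw [← hconst]
  exact hmono

/-! ### The negative lemma -/

/-- **Registered negative lemma `ceilingAllTimes_false_of_persistentJam`** (for `stub_ceilingAllTimes`
[S'] of crux stmt-AtomisticToContinuum-9518, line hemisphere-affine-slaving: FALSE modulo a
hypothesis; the stub itself is neither proved nor refuted here).  HYPOTHESIS (persistent jam;
deliberately not a literature fact — nobody has derived it for hard spheres): for SOME level `η₁ > 0`
and SOME nice profiles there is `σ₁ > 0` such that for all `0 < σ < σ₁` and every flow family there
are a window `0 ≤ t₁ < t₂` and a window-integrated limit density `ρI` with (1) a space–time law of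
large numbers for the tested density under the local Gibbs laws,
`|∫_{t₁}^{t₂}(N+1)⁻¹∑ᵢχ(xᵢ(s))ds − ∫χρI| ≤ δ` w.h.p. for every continuous `χ` and `δ > 0`, and
(2) jam: some continuous `0 ≤ χ ≤ 1` with `∫χ > 0` has `(η₁/σ³)(t₂ − t₁)∫χ < ∫χρI`.
CONCLUSION: the all-times dilute block ceiling [S'] (`DiluteAt σ a₀ θ₀ u₀ Φ t φ η₁` for all levels
`η₁ > 0`, all nice profiles, small `σ`, all flow families, ALL `t > 0` and all admissible kernel
families) fails — its ceiling `ρ̄ ≤ η₁/σ³` on all blocks and all `s ≤ t₂` forces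
`∫_{t₁}^{t₂}(N+1)⁻¹∑ᵢχ(xᵢ(s))ds ≤ (t₂ − t₁)((η₁/σ³)∫χ + ε)` on the good set once the kernel radius
is below the `ε`-modulus of `χ`, contradicting (1) at the `χ` of (2) with `ε(t₂ − t₁) = δ =` a quarter
of the gap in (2).  Kernel family: the torus mollifier
(`AprioriBoundsNegative.exists_admissibleKernelFamily`); flows: `Alexander.regHardSphereFlow`.
[folklore] -/
theorem ceilingAllTimes_false_of_persistentJam : (∃ η₁ : ℝ, 0 < η₁ ∧ ∃ (a₀ θ₀ : T3 → ℝ) (u₀ : T3 → V3), NiceProfiles a₀ θ₀ u₀ ∧ ∃ σ₁ : ℝ, 0 < σ₁ ∧ ∀ σ : ℝ, 0 < σ → σ < σ₁ → ∀ Φ : Flows σ, ∃ t₁ t₂ : ℝ, 0 ≤ t₁ ∧ t₁ < t₂ ∧ ∃ ρI : T3 → ℝ, (∀ χ : T3 → ℝ, Continuous χ → ∀ δ : ℝ, 0 < δ → Tendsto (fun N : ℕ => Literature.MathematicalPhysics.KineticTheory.localGibbsLaw σ a₀ u₀ θ₀ N (Φ N) {z | δ < |(∫ s in Icc t₁ t₂,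 Literature.MathematicalPhysics.KineticTheory.empiricalDensityField ((Φ N).flow s z) χ) - ∫ x, χ x * ρI x|}) atTop (𝓝 0)) ∧ (∃ χ : T3 → ℝ, Continuous χ ∧ (∀ x, 0 ≤ χ x) ∧ (∀ x, χ x ≤ 1) ∧ 0 < ∫ x, χ x ∧ η₁ / σ ^ 3 * (t₂ - t₁) * (∫ x, χ x) < ∫ x, χ x * ρI x)) → ¬ (∀ η₁ : ℝ, 0 < η₁ → ∀ (a₀ θ₀ : T3 → ℝ) (u₀ : T3 → V3), NiceProfiles a₀ θ₀ u₀ → ∃ σ₀ : ℝ, 0 < σ₀ ∧ ∀ σ : ℝ, 0 < σ → σ < σ₀ → ∀ (Φ : Flows σ) (t : ℝ), 0 < t → ∀ (γ C : ℝ) (φ : ℕ → T3 → ℝ), 0 < γ → γ ≤ 1 / 15 → AdmissibleKernel γ C φ → DiluteAt σ a₀ θ₀ u₀ Φ t φ η₁) := by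
  rintro ⟨η₁, hη₁, a₀, θ₀, u₀, hP, σ₁, hσ₁, hH⟩ hS
  obtain ⟨σ₀, hσ₀, hA⟩ := hS η₁ hη₁ a₀ θ₀ u₀ hP
  obtain ⟨ha, hθ, hu, ha0, hθ0⟩ := hP
  -- a common small reduced density
  have hmin : 0 < min (min σ₀ σ₁) (1 / 2) := lt_min (lt_min hσ₀ hσ₁) (by norm_num)
  set σ : ℝ := min (min σ₀ σ₁) (1 / 2) / 2 with hσdef
  have hσ : 0 < σ := half_pos hmin
  have hσlt : σ < min (min σ₀ σ₁) (1 / 2) := half_lt_self hmin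
  have hσσ₀ : σ < σ₀ := hσlt.trans_le ((min_le_left _ _).trans (min_le_left _ _))
  have hσσ₁ : σ < σ₁ := hσlt.trans_le ((min_le_left _ _).trans (min_le_right _ _))
  have hσ2 : σ < 1 / 2 := hσlt.trans_le (min_le_right _ _)
  have hσ3 : 0 < σ ^ 3 := pow_pos hσ 3
  -- a flow family (Alexander's theorem)
  set Φ : Flows σ :=
    fun N => Alexander.regHardSphereFlow (d := Fin 3) (hsDiameter_pos hσ N)
      ((hsDiameter_le hσ.le N).trans_lt (by linarith)) (N + 1) with hΦ
  obtain ⟨t₁, t₂, ht₁, ht₁₂, ρI, hconv, χ, hχc, hχ0, hχ1, hI, hM⟩ := hH σ hσ hσσ₁ Φ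
  have ht₂ : 0 < t₂ := ht₁.trans_lt ht₁₂
  have hΔ : 0 < t₂ - t₁ := sub_pos.2 ht₁₂
  -- the admissible kernel family and the ceiling claimed by [S'] at `t = t₂`
  obtain ⟨γ, C, φ, hγ, hγ', hsm, hnn, hmass, hsupp, hsup, hgrad, hint⟩ :=
    AprioriBoundsNegative.exists_admissibleKernelFamily
  have hD : DiluteAt σ a₀ θ₀ u₀ Φ t₂ φ η₁ :=
    hA σ hσ hσσ₀ Φ t₂ ht₂ γ C φ hγ hγ' ⟨hsm, hnn, hmass, hsupp, hsup, hgrad⟩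
  -- the jam test function: tested mass `I`, limit tested mass `M`, level `L`, gap `g`
  set I : ℝ := ∫ x, χ x with hIdef
  set M : ℝ := ∫ x, χ x * ρI x with hMdef
  set L : ℝ := η₁ / σ ^ 3 with hLdef
  set g : ℝ := M - L * (t₂ - t₁) * I with hgdef
  have hg : 0 < g := sub_pos.2 hM
  -- LLN tolerance and modulus of continuity
  set δ : ℝ := g / 4 with hδdef
  have hδ0 : 0 < δ := by positivity
  have hB := hconv χ hχc δ hδ0
  set ε : ℝ := g / 4 / (t₂ - t₁) with hεdef
  have hε0 : 0 < ε := by positivity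
  have hεΔ : ε * (t₂ - t₁) = g / 4 := by rw [hεdef, div_mul_cancel₀ _ hΔ.ne']
  obtain ⟨η, hη0, hηmod⟩ := Metric.uniformContinuous_iff.1
    (CompactSpace.uniformContinuous_of_continuous hχc) ε hε0
  -- the kernel radius is eventually below `η`
  have hrad : Tendsto (fun N : ℕ => ((N : ℝ) + 1) ^ (-γ)) atTop (𝓝 0) :=
    (tendsto_rpow_neg_atTop hγ).comp
      (tendsto_atTop_add_const_right _ 1 tendsto_natCast_atTop_atTop)
  obtain ⟨N₁, hN₁⟩ := eventually_atTop.1 (hrad.eventually (gt_mem_nhds hη0))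
  -- the events
  set P : (N : ℕ) → Measure (Config (N + 1) (Fin 3) T3) :=
    fun N => localGibbsLaw σ a₀ u₀ θ₀ N (Φ N) with hPdef
  set Bad : (N : ℕ) → Set (Config (N + 1) (Fin 3) T3) := fun N =>
    {z | ∃ s ∈ Icc 0 t₂, ∃ x : T3, η₁ < rhoB φ N ((Φ N).flow s z) x * σ ^ 3} with hBaddef
  set B1 : (N : ℕ) → Set (Config (N + 1) (Fin 3) T3) := fun N =>
    {z | δ < |(∫ s in Icc t₁ t₂, empiricalDensityField ((Φ N).flow s z) χ) - M|} with hB1def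
  have hT : Tendsto (fun N => P N (Bad N)) atTop (𝓝 0) := hD
  -- deterministic covering for `N ≥ N₁`
  have hcover : ∀ N, N₁ ≤ N → (univ : Set (Config (N + 1) (Fin 3) T3)) ⊆
      Bad N ∪ B1 N ∪ ((Φ N).good)ᶜ := by
    intro N hN z _
    by_cases hz : z ∈ (Φ N).good
    · by_cases h1 : δ < |(∫ s in Icc t₁ t₂, empiricalDensityField ((Φ N).flow s z) χ) - M|
      · exact Or.inl (Or.inr h1)
      by_cases hbad : z ∈ Bad N
      · exact Or.inl (Or.inl hbad)
      -- no jammed block on `[0, t₂]`, LLN `δ`-good: derive a contradiction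
      exfalso
      have hceil : ∀ s ∈ Icc t₁ t₂, ∀ x,
          empiricalDensityField ((Φ N).flow s z) (fun y => φ N (y - x)) ≤ L := by
        intro s hs x
        by_contra hlt
        have hlt' : η₁ / σ ^ 3 < rhoB φ N ((Φ N).flow s z) x := not_le.1 hlt
        exact hbad ⟨s, ⟨ht₁.trans hs.1, hs.2⟩, x, (div_lt_iff₀ hσ3).1 hlt'⟩
      have hmod : ∀ x y : T3, Torus.euclidDist (y - x) 0 < ((N : ℝ) + 1) ^ (-γ) →
          χ y ≤ χ x + ε := by
        intro x y hxy
        have hd : dist x y < η :=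
          (pj_dist_le_euclidDist_sub_zero x y).trans_lt (hxy.trans (hN₁ N hN))
        have := hηmod hd
        rw [Real.dist_eq] at this
        linarith [(abs_lt.1 this).1, (abs_lt.1 this).2]
      have hpt : ∀ s ∈ Icc t₁ t₂,
          empiricalDensityField ((Φ N).flow s z) χ ≤ L * I + ε := fun s hs =>
        pj_empiricalDensityField_le_of_blockCeiling ((Φ N).flow s z) (hnn N) (hint N)
          (hmass N) (hsupp N) hχc hχ0 hχ1 hmod (hceil s hs)
      have hupint : (∫ s in Icc t₁ t₂, empiricalDensityField ((Φ N).flow s z) χ) ≤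
          (L * I + ε) * (t₂ - t₁) :=
        pj_setIntegral_empiricalDensityField_le_mul (Φ N) hz hχc hχ0 hχ1 ht₁₂.le hpt
      have hlowint : M - δ ≤ ∫ s in Icc t₁ t₂, empiricalDensityField ((Φ N).flow s z) χ := by
        have := (abs_le.1 (not_lt.1 h1)).1
        linarith
      -- arithmetic: `M - g/4 ≤ (L I + ε)(t₂ - t₁) = M - g + g/4`
      have hexp : (L * I + ε) * (t₂ - t₁) = M - g + g / 4 := by
        rw [add_mul, hεΔ, hgdef]; ring
      rw [hexp] at hupint
      rw [hδdef] at hlowint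
      linarith
    · exact Or.inr hz
  have hbound : ∀ N, N₁ ≤ N → (1 : ℝ≥0∞) ≤ P N (Bad N) + P N (B1 N) := by
    intro N hN
    haveI := isProbabilityMeasure_localGibbsLaw ha hθ hu ha0 hθ0 hσ2.le N (Φ N)
    have hgood : P N ((Φ N).good)ᶜ = 0 := by
      rw [hPdef]
      show localGibbsLaw σ a₀ u₀ θ₀ N (Φ N) ((Φ N).good)ᶜ = 0
      rw [localGibbsLaw_eq]
      exact localGibbsMeasure_absolutelyContinuous σ a₀ u₀ θ₀ N (Φ N) (Φ N).measure_compl_good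
    calc (1 : ℝ≥0∞) = P N univ := measure_univ.symm
      _ ≤ P N (Bad N ∪ B1 N ∪ ((Φ N).good)ᶜ) := measure_mono (hcover N hN)
      _ ≤ P N (Bad N ∪ B1 N) + P N ((Φ N).good)ᶜ := measure_union_le _ _
      _ ≤ P N (Bad N) + P N (B1 N) + P N ((Φ N).good)ᶜ :=
          add_le_add (measure_union_le _ _) le_rfl
      _ = P N (Bad N) + P N (B1 N) := by rw [hgood, add_zero]
  have hlim : Tendsto (fun N => P N (Bad N) + P N (B1 N)) atTop (𝓝 0) := by
    have h := hT.add hB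
    rw [add_zero] at h
    exact h
  have h10 : (1 : ℝ≥0∞) ≤ 0 :=
    ge_of_tendsto hlim (eventually_atTop.2 ⟨N₁, fun N hN => hbound N hN⟩)
  exact absurd h10 (by norm_num)

end

end Summit.AtomisticToContinuum.HydrodynamicLimit.Theorems.HemisphereAffineSlaving
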